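import Literature.Analysis.FluidPDE.DuchonRobert
import Literature.Analysis.FluidPDE.EyinkFourFifthsHolds
import HarnessLib

/-!
# The local 4/5 and 4/3 laws on `𝕋³` (turb.S18): discharge of `eyink_local_four_fifths`

Topic: Analysis/FluidPDE, proofs companion to `Literature.Analysis.FluidPDE.DuchonRobert` (which
cannot host this proof itself: the assembly files below import it).

The named fact `FluidPDE.eyink_local_four_fifths` (`DuchonRobert`, turb.S18) asserts, for every weak
Euler solution `u ∈ L³((0,T) × 𝕋³)` (`Torus.IsWeakEulerSolutionOn`, guarded mixed class
`Torus.MemLqLp 3 3 u (Ioo 0 T)`) with a Duchon–Robert defect `D` (`Torus.HasDuchonRobertDefect`), the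
local 4/5 law `Torus.HasFourFifthsLaw T u D` and the local 4/3 law `Torus.HasFourThirdsLaw T u D`.
It is the conjunction, at `d = Fin 3`, of the two accepted facts
`Torus.HasDuchonRobertDefect.hasFourFifthsLaw` and `Torus.HasDuchonRobertDefect.hasFourThirdsLaw`
(`DissipationAnomaly`), up to the conversion `MemLqLp 3 3 → ∫₀ᵀ∫ ‖u‖³ < ∞`
(`Torus.lintegral_pow_three_lt_top_of_memLqLp`, `DuchonRobertLocalBalance`).

**Sources and their exact scope.** Duchon–Robert 2000, §4, (11)–(12) print the 4/3 identification
`S(u) = −(4/3) D(u)` *assuming the shell limit `S(u) = 𝒟-lim_{ℓ→0} S(u,ℓ)` exists*, and Eyink 2003,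
Thm. 1 / Cor. 1 print the 4/5 (and 8/15) identification under the same kind of assumption
(arXiv:nlin/0208004, p. 4 Thm. 1, p. 5 Cor. 1: "Assume that the functions `S_L(u,ℓ)`, `S_T(u,ℓ)` …
have limits … Then `S_L(u) = −(4/5) D(u)`"). The *existence* of the limits for every `L³` weak Euler
solution — which the fact asserts — is Novack 2024, Thm. 1; the tree proves it along Duchon–Robert's
and Eyink's own regularisations via *uniform* defects (`DuchonRobertUniformDefect(OfEuler)`,
`EyinkUniformDefect…`, `EyinkTransverseLimit`), the pressure being reconstructed by the
Calderón–Zygmund theory on `𝕋³` (`Torus.exists_pressure_of_tendsto_L3_holds_fin3`).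

## Results (all proved, no named fact introduced)

* `Torus.hasFourThirdsLaw_of_pressure_fact`: the accepted fact
  `Torus.HasDuchonRobertDefect.hasFourThirdsLaw` in every dimension from the pressure fact
  `Torus.exists_pressure_of_tendsto_L3` alone (`Torus.hasFourThirdsLaw_of_symmTestField_identity_of_pressure`
  fed with the discharged tested momentum equation `Torus.symmTestField_identity_holds`);
* `Torus.hasFourThirdsLaw_of_card_le_three`, `Torus.HasDuchonRobertDefect.hasFourThirdsLaw_holds_fin3`:
  the 4/3 fact unconditionally on tori of dimension `≤ 3`, in particular on `𝕋³` (twin of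
  `Torus.HasDuchonRobertDefect.hasFourFifthsLaw_holds_fin3`, `EyinkFourFifthsHolds`);
* `FluidPDE.eyink_local_four_fifths_holds`: **the discharge of turb.S18.**

## References

* J. Duchon, R. Robert, *Inertial energy dissipation for weak solutions of incompressible Euler and
  Navier–Stokes equations*, Nonlinearity 13 (2000) 249–255, Prop. 2, §4 (11)–(12). [DuchonRobert2000]
* G. L. Eyink, *Local 4/5-law and energy dissipation anomaly in turbulence*, Nonlinearity 16 (2003)
  137–145 = arXiv:nlin/0208004, §2 Thm. 1, Cor. 1. [Eyink2003]
* M. Novack, *Scaling laws and exact results in turbulence*, Nonlinearity 37 (2024) 095002 =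
  arXiv:2310.01375, Thm. 1. [Novack2024]
-/

noncomputable section

open MeasureTheory Set Filter
open scoped ENNReal

namespace Literature.Analysis.FluidPDE.Torus

variable {d : Type*} [Fintype d] {T : ℝ} {u : ℝ → UnitAddTorus d → EuclideanSpace ℝ d}

/-- **The local 4/3 law from the pressure fact alone, in every dimension.** With Duchon–Robert's
cubic identity (`Torus.integral_kernelFlux_mul_eq_holds`) and tested momentum equation
(`Torus.symmTestField_identity_holds`) discharged in the tree, the accepted fact
`Torus.HasDuchonRobertDefect.hasFourThirdsLaw` follows from the `L^{3/2}` pressure fact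
`Torus.exists_pressure_of_tendsto_L3` (`Torus.hasFourThirdsLaw_of_symmTestField_identity_of_pressure`:
pressure ⇒ distributional solution ⇒ uniform Duchon–Robert defect ⇒ shell limit; Duchon–Robert 2000,
§4 (11)–(12), made unconditional as in Novack 2024, Thm. 1). [cite: DuchonRobert2000, §4 (11)–(12)] -/
theorem hasFourThirdsLaw_of_pressure_fact (hA1 : exists_pressure_of_tendsto_L3 (T := T) (u := u)) :
    HasDuchonRobertDefect.hasFourThirdsLaw (T := T) (u := u) :=
  hasFourThirdsLaw_of_symmTestField_identity_of_pressure (fun {_} => symmTestField_identity_holds) hA1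

/-- **The local 4/3 law on tori of dimension at most three, unconditionally**: for every finite index
type `d` with `card d ≤ 3`, every `L³` weak Euler solution on `T^d × (0,T)` with a Duchon–Robert
defect satisfies `Torus.HasFourThirdsLaw` with that defect (the pressure fact is proved there,
`Torus.exists_pressure_of_tendsto_L3_of_card_le_three`). [cite: DuchonRobert2000, §4 (11)–(12)] -/
theorem hasFourThirdsLaw_of_card_le_three (hcard : Fintype.card d ≤ 3) :
    HasDuchonRobertDefect.hasFourThirdsLaw (T := T) (u := u) :=
  hasFourThirdsLaw_of_pressure_fact (exists_pressure_of_tendsto_L3_of_card_le_three hcard)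

/-- **Duchon–Robert's local 4/3 law on the physical torus `𝕋³`, unconditionally**: the accepted fact
`Torus.HasDuchonRobertDefect.hasFourThirdsLaw` holds for `d = Fin 3` (twin of
`Torus.HasDuchonRobertDefect.hasFourFifthsLaw_holds_fin3`). [cite: DuchonRobert2000, §4 (11)–(12)] -/
theorem HasDuchonRobertDefect.hasFourThirdsLaw_holds_fin3 {T : ℝ}
    {u : ℝ → UnitAddTorus (Fin 3) → EuclideanSpace ℝ (Fin 3)} :
    HasDuchonRobertDefect.hasFourThirdsLaw (T := T) (u := u) :=
  hasFourThirdsLaw_of_card_le_three (by simp)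

end Literature.Analysis.FluidPDE.Torus

namespace Literature.Analysis.FluidPDE

/-- **turb.S18 discharged: the local 4/5 and 4/3 laws on `𝕋³`.** For every weak Euler solution
`u ∈ L³((0,T) × 𝕋³)` with Duchon–Robert defect `D`, in the sense of distributions on `(0,T) × 𝕋³`,
`lim_{ℓ→0⁺} ℓ⁻¹ ⨍ (δ_L u(ℓω))³ dω = −(4/5) D` and `lim_{ℓ→0⁺} ℓ⁻¹ ⨍ δ_L u |δu|²(ℓω) dω = −(4/3) D`
— the named fact `eyink_local_four_fifths`, from the tree's unconditional proofs of the two accepted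
facts on `𝕋³` (`Torus.HasDuchonRobertDefect.hasFourFifthsLaw_holds_fin3`, `EyinkFourFifthsHolds`;
`Torus.HasDuchonRobertDefect.hasFourThirdsLaw_holds_fin3` above) and the conversion of the guarded
mixed class `MemLqLp 3 3` to `∫₀ᵀ∫ ‖u‖³ < ∞` (`Torus.lintegral_pow_three_lt_top_of_memLqLp`).
Printed (conditional-on-the-limit) sources: Eyink 2003, Thm. 1 / Cor. 1; Duchon–Robert 2000, §4
(11)–(12); existence of the limits: Novack 2024, Thm. 1. [cite: Eyink2003, §2 Thm. 1 and Cor. 1] -/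
theorem eyink_local_four_fifths_holds : eyink_local_four_fifths := by
  intro T u D hD hE hu3
  have hu3' : ∫⁻ t in Ioo 0 T, ∫⁻ x, ‖u t x‖ₑ ^ (3 : ℕ) < ∞ :=
    Torus.lintegral_pow_three_lt_top_of_memLqLp hu3
  exact ⟨Torus.HasDuchonRobertDefect.hasFourFifthsLaw_holds_fin3 hD hE hu3',
    Torus.HasDuchonRobertDefect.hasFourThirdsLaw_holds_fin3 hD hE hu3'⟩

end Literature.Analysis.FluidPDE
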